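import Literature.Computability.AlgebraicComplexity.BorderRankMatMulSmallProofs
import HarnessLib

/-!
# Integer certificates for approximate decompositions (`R_h(t) ≤ r`, `bR(t) ≤ r`, `R(t) ≤ r`), checked by `decide`

Topic `Literature/Computability/AlgebraicComplexity`; a trunk-independent TOOL, the upper-bound
companion of the integer row certificates `LinearAlgebra/Matrix/IntRowCertificate.lean` (which certify
flattening-rank LOWER bounds).  Everything here is PROVED; nothing is specific to one tensor.

The object certified is Bläser's order-`h` approximate decomposition (`SchoenhageTau.IsApproxDecomposition`,
Bläser 2013, Def. 6.1): `∑_{ρ<r} u_ρ(ε) ⊗ v_ρ(ε) ⊗ w_ρ(ε) = ε^h · t + O(ε^{h+1})` with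
`u_ρ(ε), v_ρ(ε), w_ρ(ε)` vectors of polynomials in `ε`.  When the polynomials have INTEGER
coefficients the defining identities are finitely many integer polynomial identities, and their
truncations to degree `≤ h` are a closed Boolean computation:

* `ApproxCert.check a b c r h D T U V W` — for a format `a × b × c`, an integer tensor
  `T : Fin a → Fin b → Fin c → ℤ`, an integer multiplier `D` and certificate data
  `U ρ i, V ρ j, W ρ l : List ℤ` (ascending coefficient lists of `u_ρ(ε)_i`, `v_ρ(ε)_j`, `w_ρ(ε)_l`),
  checks that for every entry `(i, j, l)` the polynomial `∑_ρ U ρ i · V ρ j · W ρ l`, computed over `ℤ`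
  modulo `ε^{h+1}` (`ptrunc`), has coefficients `0, …, 0, D · T i j l` in degrees `0, …, h`
  (`lowCheck`, one pass over the list);
* `ApproxCert.isApproxDecomposition_of_check` — a successful check IS an order-`h` approximate
  decomposition of the tensor `D · T` with `r` triads over `K[ε]`, for EVERY commutative ring `K`;
* `ApproxCert.approxRank_le_of_check`, `algBorderRank_le_of_check`, `tensorRank_le_of_check` (`h = 0`)
  — hence `R_h(T) ≤ r`, `bR(T) ≤ r` (and `R(T) ≤ r` when `h = 0`) over every commutative ring `K` in
  which `D` is a unit (`D = 1`: every commutative ring; the multiplier is how certificates found over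
  `ℚ` are cleared of denominators: rescale each triad's three factors by integers and collect the
  common factor `D`), via the rescaling lemma `approxRank_le_of_isApproxDecomposition_mul`;
* `ApproxCert.ofEntries` — an integer tensor given by a sparse list of entries, the input format of
  the tables that use this tool.

The integer polynomial arithmetic on coefficient lists (`toPoly`, `coeffL`, `padd`, `psmul`, `pmul`,
`psum` and their homomorphism lemmas) is REUSED from `BorderRankMatMulSmallProofs.lean` (namespace
`Smirnov2013`, where it certifies Smirnov's `bR(⟨3,2,3⟩) ≤ 14` for one fixed format), and extended
here by truncation `ptrunc` modulo `ε^{h+1}` (lemma `coeff_mul_congr_of_lt`: the coefficients of a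
product below degree `n` only depend on the coefficients of the factors below degree `n`), so that
certificates of large order `h` with high-degree entries stay cheap to check in the kernel, by the
one-pass comparison `lowCheck`, and by the format-generic soundness statements.
Intended use: `theorem foo_check : ApproxCert.check … = true := by decide +kernel` on literal data,
then the soundness theorems.  Certificates are FOUND outside Lean (computer algebra, numerical
optimisation + rationalisation, interpolation designs); only their verification is in the kernel.

First client: the 55 normal forms of concise tensors of minimal border rank in `K^m ⊗ K^m ⊗ K^m`,
`m ≤ 5` (Jagiełła–Jelisiejew 2026), `JagiellaJelisiejew2026MinimalBorderRank.lean`.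

## References

* [Blaser2013] M. Bläser, *Fast Matrix Multiplication*, Theory of Computing Library, Graduate
  Surveys 5 (2013) — Def. 6.1 (`R_h`, border rank over `K[ε]`), Rem. 6.2.
* [BurgisserClausenShokrollahi1997] P. Bürgisser, M. Clausen, M. A. Shokrollahi, *Algebraic
  Complexity Theory*, Springer 1997 — §15.4 (degeneration and border rank, (15.19)–(15.20)).
-/

noncomputable section

open scoped BigOperators Polynomial
open Polynomial

namespace Literature.Computability.AlgebraicComplexity

namespace ApproxCert

open Smirnov2013 (toPoly coeffL padd psmul pmul psum coeff_toPoly toPoly_padd toPoly_psmul toPoly_pmul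
  toPoly_psum)

/-! ## Dense integer polynomials in `ε` as ascending coefficient lists: truncation

The arithmetic itself — `toPoly : List ℤ → K[X]`, `coeffL`, `padd`, `psmul`, `pmul`, `psum` and the
homomorphism lemmas `coeff_toPoly`, `toPoly_padd`, `toPoly_psmul`, `toPoly_pmul`, `toPoly_psum` — is
REUSED from `BorderRankMatMulSmallProofs.lean` (namespace `Smirnov2013`, opened here). -/

section Poly

variable {K : Type*} [CommRing K]

/-- Truncation to the first `n` coefficients (reduction modulo `ε^n`). [folklore] -/
def ptrunc : ℕ → List ℤ → List ℤ
  | 0, _ => []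
  | _ + 1, [] => []
  | n + 1, c :: cs => c :: ptrunc n cs

/-- Truncation modulo `ε^n` does not change the coefficients below degree `n`. [folklore] -/
theorem coeffL_ptrunc : ∀ (n : ℕ) (l : List ℤ) (d : ℕ), d < n → coeffL (ptrunc n l) d = coeffL l d
  | 0, _, _, hd => absurd hd (Nat.not_lt_zero _)
  | _ + 1, [], _, _ => by simp [ptrunc, coeffL]
  | _ + 1, _ :: _, 0, _ => by simp [ptrunc, coeffL]
  | n + 1, c :: cs, d + 1, hd => by
    rw [ptrunc, coeffL, coeffL]
    exact coeffL_ptrunc n cs d (by omega)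

/-- The coefficients of `toPoly (ptrunc n l)` and `toPoly l` agree below degree `n`. [folklore] -/
theorem coeff_toPoly_ptrunc (n : ℕ) (l : List ℤ) (d : ℕ) (hd : d < n) :
    (toPoly (ptrunc n l) : K[X]).coeff d = (toPoly l : K[X]).coeff d := by
  rw [coeff_toPoly, coeff_toPoly, coeffL_ptrunc n l d hd]

/-- The coefficients of a product below degree `n` only depend on the coefficients of the factors
below degree `n` (computing modulo `ε^n`). [folklore] -/
theorem coeff_mul_congr_of_lt {n : ℕ} {p p' q q' : K[X]} (hp : ∀ d < n, p.coeff d = p'.coeff d)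
    (hq : ∀ d < n, q.coeff d = q'.coeff d) : ∀ d < n, (p * q).coeff d = (p' * q').coeff d := by
  intro d hd
  rw [coeff_mul, coeff_mul]
  refine Finset.sum_congr rfl fun x hx => ?_
  have hx' := Finset.HasAntidiagonal.mem_antidiagonal.1 hx
  rw [hp x.1 (by omega), hq x.2 (by omega)]

end Poly

/-! ## The certificate check -/

/-- The `(i,j,l)` entry polynomial `∑_ρ u_ρ(ε)_i v_ρ(ε)_j w_ρ(ε)_l` computed over `ℤ` modulo `ε^n`
(both products truncated), for the coefficient lists `U ρ = u_ρ(ε)_i`, `V ρ = v_ρ(ε)_j`,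
`W ρ = w_ρ(ε)_l` of the `r` triads at a fixed entry. [cite: Blaser2013, Def. 6.1] -/
def entryPoly (n r : ℕ) (U V W : Fin r → List ℤ) : List ℤ :=
  psum (List.ofFn fun ρ : Fin r => ptrunc n (pmul (ptrunc n (pmul (U ρ) (V ρ))) (W ρ)))

/-- `lowCheck l k t`: the coefficient list `l` reads `0, …, 0, t` in degrees `0, …, k` (one pass).
[folklore] -/
def lowCheck : List ℤ → ℕ → ℤ → Bool
  | [], 0, t => t == 0
  | c :: _, 0, t => c == t
  | [], _ + 1, t => t == 0
  | c :: cs, k + 1, t => (c == 0) && lowCheck cs k t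

/-- What `lowCheck` says, coefficient by coefficient. [folklore] -/
theorem coeffL_of_lowCheck : ∀ (l : List ℤ) (k : ℕ) (t : ℤ), lowCheck l k t = true →
    ∀ d ≤ k, coeffL l d = if d = k then t else 0
  | [], 0, t, h, d, hd => by
    obtain rfl : d = 0 := Nat.le_zero.1 hd
    simp only [lowCheck, beq_iff_eq] at h
    simp [coeffL, h]
  | c :: _, 0, t, h, d, hd => by
    obtain rfl : d = 0 := Nat.le_zero.1 hd
    simp only [lowCheck, beq_iff_eq] at h
    simp [coeffL, h]
  | [], k + 1, t, h, d, hd => by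
    simp only [lowCheck, beq_iff_eq] at h
    simp [coeffL, h]
  | c :: cs, k + 1, t, h, 0, _ => by
    simp only [lowCheck, Bool.and_eq_true, beq_iff_eq] at h
    simp [coeffL, h.1]
  | c :: cs, k + 1, t, h, d + 1, hd => by
    simp only [lowCheck, Bool.and_eq_true, beq_iff_eq] at h
    rw [coeffL, coeffL_of_lowCheck cs k t h.2 d (by omega)]
    simp

/-- **The certificate check** for `∑_{ρ<r} u_ρ ⊗ v_ρ ⊗ w_ρ = ε^h · (D·T) + O(ε^{h+1})` with integer
data: for every entry `(i,j,l)` of the `a × b × c` format, the entry polynomial (computed modulo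
`ε^{h+1}`) has coefficients `0, …, 0, D · T i j l` in degrees `0, …, h`.  A closed Boolean computation
over `ℤ`, meant to be evaluated by `decide` / `decide +kernel`. [cite: Blaser2013, Def. 6.1] -/
def check (a b c r h : ℕ) (D : ℤ) (T : Fin a → Fin b → Fin c → ℤ) (U : Fin r → Fin a → List ℤ)
    (V : Fin r → Fin b → List ℤ) (W : Fin r → Fin c → List ℤ) : Bool :=
  (List.finRange a).all fun i => (List.finRange b).all fun j => (List.finRange c).all fun l =>
    lowCheck (entryPoly (h + 1) r (fun ρ => U ρ i) (fun ρ => V ρ j) (fun ρ => W ρ l)) h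
      (D * T i j l)

/-- Unpacking a successful check: entry by entry, degree by degree. [cite: Blaser2013, Def. 6.1] -/
theorem coeffL_entryPoly_of_check {a b c r h : ℕ} {D : ℤ} {T : Fin a → Fin b → Fin c → ℤ}
    {U : Fin r → Fin a → List ℤ} {V : Fin r → Fin b → List ℤ} {W : Fin r → Fin c → List ℤ}
    (hc : check a b c r h D T U V W = true) (i : Fin a) (j : Fin b) (l : Fin c) {d : ℕ}
    (hd : d ≤ h) :
    coeffL (entryPoly (h + 1) r (fun ρ => U ρ i) (fun ρ => V ρ j) (fun ρ => W ρ l)) d =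
      if d = h then D * T i j l else 0 := by
  simp only [check, List.all_eq_true] at hc
  exact coeffL_of_lowCheck _ _ _
    (hc i (List.mem_finRange i) j (List.mem_finRange j) l (List.mem_finRange l)) d hd

/-! ## Soundness -/

section Sound

variable (K : Type*) [CommRing K]

/-- The entry polynomial computed modulo `ε^n` has, below degree `n`, the coefficients of the true
entry `∑_ρ u_ρ(ε)_i v_ρ(ε)_j w_ρ(ε)_l ∈ K[ε]`. [folklore] -/
theorem coeff_sum_eq_coeff_toPoly_entryPoly (n r : ℕ) (U V W : Fin r → List ℤ) (d : ℕ)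
    (hd : d < n) :
    (∑ ρ, (toPoly (U ρ) * toPoly (V ρ) * toPoly (W ρ) : K[X])).coeff d =
      (toPoly (entryPoly n r U V W) : K[X]).coeff d := by
  rw [entryPoly, toPoly_psum, List.map_ofFn, List.sum_ofFn, finsetSum_coeff, finsetSum_coeff]
  refine Finset.sum_congr rfl fun ρ _ => ?_
  simp only [Function.comp_apply]
  symm
  rw [coeff_toPoly_ptrunc n _ d hd, toPoly_pmul]
  exact coeff_mul_congr_of_lt (n := n)
    (fun d' hd' => by rw [coeff_toPoly_ptrunc n _ d' hd', toPoly_pmul]) (fun _ _ => rfl) d hd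

variable {K}

/-- **Soundness.** A successful check is an order-`h` approximate decomposition of `D · T` with `r`
triads over `K[ε]`, for every commutative ring `K`. [cite: Blaser2013, Def. 6.1] -/
theorem isApproxDecomposition_of_check {a b c r h : ℕ} {D : ℤ} {T : Fin a → Fin b → Fin c → ℤ}
    {U : Fin r → Fin a → List ℤ} {V : Fin r → Fin b → List ℤ} {W : Fin r → Fin c → List ℤ}
    (hc : check a b c r h D T U V W = true) :
    IsApproxDecomposition h (fun i j l => ((D * T i j l : ℤ) : K)) (fun ρ i => toPoly (U ρ i))
      (fun ρ j => toPoly (V ρ j)) (fun ρ l => toPoly (W ρ l)) := by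
  intro i j l d hd
  rw [coeff_sum_eq_coeff_toPoly_entryPoly K (h + 1) r (fun ρ => U ρ i) (fun ρ => V ρ j)
    (fun ρ => W ρ l) d (by omega), coeff_toPoly, coeffL_entryPoly_of_check hc i j l hd]
  split_ifs <;> simp

/-- Rescaling: an order-`h` approximate decomposition of `d · t` with `r` triads, `d` a unit of `K`,
gives one of `t` (multiply the first factors by `d⁻¹`), so `R_h(t) ≤ r`. [cite: Blaser2013, Def. 6.1] -/
theorem approxRank_le_of_isApproxDecomposition_mul {ι κ μ : Type*} {h : ℕ} {t : ι → κ → μ → K}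
    {r : ℕ} {u : Fin r → ι → K[X]} {v : Fin r → κ → K[X]} {w : Fin r → μ → K[X]} {d : K}
    (hd : IsUnit d) (H : IsApproxDecomposition h (fun a b c => d * t a b c) u v w) :
    approxRank h t ≤ r := by
  obtain ⟨e, he⟩ := hd.exists_left_inv
  refine approxRank_le_of_isApproxDecomposition (u := fun ρ a => C e * u ρ a) (v := v) (w := w) ?_
  intro a b c j hj
  have hsum : (∑ ρ, C e * u ρ a * v ρ b * w ρ c) = C e * ∑ ρ, u ρ a * v ρ b * w ρ c := by
    rw [Finset.mul_sum]
    exact Finset.sum_congr rfl fun ρ _ => by ring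
  rw [hsum, coeff_C_mul, H a b c j hj]
  split_ifs
  · rw [← mul_assoc, he, one_mul]
  · rw [mul_zero]

/-- **`R_h(T) ≤ r`** from a checked certificate, over every commutative ring in which the multiplier
`D` is a unit. [cite: Blaser2013, Def. 6.1] -/
theorem approxRank_le_of_check (K : Type*) [CommRing K] {a b c r h : ℕ} {D : ℤ}
    {T : Fin a → Fin b → Fin c → ℤ} {U : Fin r → Fin a → List ℤ} {V : Fin r → Fin b → List ℤ}
    {W : Fin r → Fin c → List ℤ} (hc : check a b c r h D T U V W = true) (hD : IsUnit (D : K)) :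
    approxRank h (fun i j l => (T i j l : K)) ≤ r := by
  have H := isApproxDecomposition_of_check (K := K) hc
  simp only [Int.cast_mul] at H
  exact approxRank_le_of_isApproxDecomposition_mul hD H

/-- **`bR(T) ≤ r`** from a checked certificate, over every commutative ring in which the multiplier
`D` is a unit. [cite: Blaser2013, Def. 6.1] -/
theorem algBorderRank_le_of_check (K : Type*) [CommRing K] {a b c r h : ℕ} {D : ℤ}
    {T : Fin a → Fin b → Fin c → ℤ} {U : Fin r → Fin a → List ℤ} {V : Fin r → Fin b → List ℤ}
    {W : Fin r → Fin c → List ℤ} (hc : check a b c r h D T U V W = true) (hD : IsUnit (D : K)) :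
    algBorderRank (fun i j l => (T i j l : K)) ≤ r :=
  (algBorderRank_le_approxRank h _).trans (approxRank_le_of_check K hc hD)

/-- **`R(T) ≤ r`** from a checked certificate of order `h = 0` (an exact decomposition, `R_0 = R`),
over every commutative ring in which `D` is a unit. [cite: Blaser2013, Rem. 6.2] -/
theorem tensorRank_le_of_check (K : Type*) [CommRing K] {a b c r : ℕ} {D : ℤ}
    {T : Fin a → Fin b → Fin c → ℤ} {U : Fin r → Fin a → List ℤ} {V : Fin r → Fin b → List ℤ}
    {W : Fin r → Fin c → List ℤ} (hc : check a b c r 0 D T U V W = true) (hD : IsUnit (D : K)) :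
    tensorRank (fun i j l => (T i j l : K)) ≤ r :=
  (approxRank_zero _).symm.le.trans (approxRank_le_of_check K hc hD)

/-- **`bR(T) ≤ r` over EVERY commutative ring** from a checked certificate with multiplier `D = 1`.
[cite: Blaser2013, Def. 6.1] -/
theorem algBorderRank_le_of_check_one (K : Type*) [CommRing K] {a b c r h : ℕ}
    {T : Fin a → Fin b → Fin c → ℤ} {U : Fin r → Fin a → List ℤ} {V : Fin r → Fin b → List ℤ}
    {W : Fin r → Fin c → List ℤ} (hc : check a b c r h 1 T U V W = true) :
    algBorderRank (fun i j l => (T i j l : K)) ≤ r :=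
  algBorderRank_le_of_check K hc (by simp)

/-- **`R(T) ≤ r` over EVERY commutative ring** from a checked order-`0` certificate with `D = 1`.
[cite: Blaser2013, Rem. 6.2] -/
theorem tensorRank_le_of_check_one (K : Type*) [CommRing K] {a b c r : ℕ}
    {T : Fin a → Fin b → Fin c → ℤ} {U : Fin r → Fin a → List ℤ} {V : Fin r → Fin b → List ℤ}
    {W : Fin r → Fin c → List ℤ} (hc : check a b c r 0 1 T U V W = true) :
    tensorRank (fun i j l => (T i j l : K)) ≤ r :=
  tensorRank_le_of_check K hc (by simp)

end Sound

/-! ## Sparse input formats -/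

/-- The dense coefficient list of a sparse list of monomials `(degree, coefficient)` (their sum).
[folklore] -/
def ofSparse : List (ℕ × ℤ) → List ℤ
  | [] => []
  | dc :: l => padd (List.replicate dc.1 0 ++ [dc.2]) (ofSparse l)

/-- The integer tensor of format `a × b × c` with the listed entries `((i, j, l), value)` (first match;
`0` elsewhere) — the input format of the certificate tables. [folklore] -/
def ofEntries (a b c : ℕ) (E : List ((ℕ × ℕ × ℕ) × ℤ)) : Fin a → Fin b → Fin c → ℤ :=
  fun i j l => ((E.find? fun e => e.1 == (i.val, j.val, l.val)).map Prod.snd).getD 0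

/-! ## A worked example: `bR(k[x]/(x²)) ≤ 2` over every commutative ring -/

/-- The structure tensor of `k[x]/(x²)` in the basis `1, x` (the `m = 2` concise tensor of border
rank `2` and rank `3`; `W`-state): entries `(0,0,0), (0,1,1), (1,0,1)`. [cite: Blaser2013, §6.1] -/
def dualNumbers : Fin 2 → Fin 2 → Fin 2 → ℤ :=
  ofEntries 2 2 2 [((0, 0, 0), 1), ((0, 1, 1), 1), ((1, 0, 1), 1)]

/-- The order-`1` certificate `(1, ε) ⊗ (1, ε) ⊗ (ε, 1) - (1, 0) ⊗ (1, 0) ⊗ (0, 1)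
 = ε · dualNumbers + O(ε²)` checks. [cite: Blaser2013, §6.1] -/
theorem dualNumbers_check :
    check 2 2 2 2 1 1 dualNumbers (![![[1], [0, 1]], ![[-1], []]]) (![![[1], [0, 1]], ![[1], []]])
      (![![[0, 1], [1]], ![[], [1]]]) = true := by
  decide +kernel

/-- `bR(k[x]/(x²)) ≤ 2` over every commutative ring. [cite: Blaser2013, §6.1] -/
theorem algBorderRank_dualNumbers_le (K : Type*) [CommRing K] :
    algBorderRank (fun i j l => (dualNumbers i j l : K)) ≤ 2 :=
  algBorderRank_le_of_check_one K dualNumbers_check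

end ApproxCert

end Literature.Computability.AlgebraicComplexity
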